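import Summits.NavierStokesRegularity.NavierStokesRegularity.Theorems.TaoLadderRungTwoFlatEntryHandover
import HarnessLib

/-!
# ENTRY HAND-OVER 52 — the capture → tube entry hop of `H(n)` (child 2A `GradedAdiabaticWakeA` of the K_A♭ split of
  route TaoLadderRungTwoFlat; cell harvest/h2-tao-ladder, theory-1 g40, numT52; LADDER §52)

PROVENANCE (p1 g22): part 2 of theory-1 g40's image of record numT52/EntryHandover52.lean sha16 0e05a3a013d73267 —
the LANDING wrappers `core_landing_of_window_and_tail(₂)`, `core_landing_of_gauge_capture`, `near_landing_of_sup`,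
`behind_landing_of_sup` (producing exactly the hypotheses of `HopTube.coreClause_recentre` / `nearClause_recentre` /
`behindClause_recentre`), the budget-order lemmas `entry_window_budget(₂)` and the flat specialisation
`behindClause_flat_iff` / `ratioFloor_flat`; declarations BYTE-IDENTICAL; part 1 = `…EntryHandover`. The image's module
docstring is repeated verbatim below for the reader of this part.

WHAT THIS FILE FIXES. At the ENTRY hop `n = N₀` the premise of every zone obligation (`TubeStepCore/Near/Behind N₀`,
module `…HopTube`) is a CAPTURE state (`CaptureClause`: sup-ball of radius `η N₀` around the canonical checkpoint
state `ζ N₀`, plus `AheadClause`), while the conclusion is the full zone description at `N₀ + 1` (core = GAUGE distance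
on the half-line `k ≥ -K`, near = co-moving block energy, behind = sup envelope). Sup-closeness does NOT convert to
gauge-closeness on the half-line (the gauge `g^{k⁺}` is unbounded ahead), so the entry core clause is assembled from
THREE sources: (W) on the finite window `-K ≤ k < k₁` — sup-closeness `η₁` of the landed state to a reference state
`ref` (the datum solution's checkpoint, by finite-time continuity L3) + gauge-closeness `δ₁` of `ref` to the pulse
family member `x_r·u⋆` (child 1's clause (WG), WINDOW part only) + the anchor-scale mismatch `|x − x_r| ≤ ξ`;
(T1) on the tail `k ≥ k₁` — the landed `AheadClause` (`8·w k·|y| ≤ a·r`) read in the gauge through the domination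
`ω_k·(a r) ≤ 8 δ₂ w_k` (Gaussian `w` beats geometric `ω`; `r = r₁ε₀` makes `δ₂ → 0`); (T2) the pulse's own gauge tail
`ω_k·x·|u⋆ k| ≤ δ₃` beyond `k₁` (doubly-exponential profile decay beats `g^k`; fixes `k₁ ≥ k⋆(δ̄)`, `ε₀`-free).
Kernel-checked here (no `sorry`): the bookkeeping inequalities `gauge_dev_le_of_window_and_tail` (W)+(T1)+(T2) ⇒
`ω·|y − x·u⋆| ≤ max(G η₁ + δ₁ + G ξ M_u, δ₂ + δ₃)` on `k ≥ -K`; `gauge_tail_of_ahead` (T1); the window gauge bound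
`geomGauge_le_pow_of_lt` (`G = g^{k₁⁺}`); the LANDING wrappers `core_landing_of_window_and_tail`,
`near_landing_of_sup`, `behind_landing_of_sup` producing exactly the hypotheses of `coreClause_recentre` /
`nearClause_recentre` / `behindClause_recentre` (module `…HopTubeLanding`); the (WG)-rewriting `gauge_close_sectionState`
(`κ·Φ(0) = x_r · u⋆` with `u⋆ = sectionState A_* i₀ Φ(0)`, `x_r = κ|Φ_{i₀,0}(0)|/A_*`); the budget-order lemma
`entry_window_budget` (given `G, M_u, A_*, ω₀, δ̄`: ONE smallness `t = η₁ = δ₁` achieving the window half of the core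
budget — the order of constants is `K → δ̄ → (δ₁, η₁) → N₀` (from (WG) at `(K + D, δ₁)`) `→ ε₀ ≤ ε_cap(N₀, η₁) ∧ ε_entry(δ̄)`);
and the FLAT specialisation `behindClause_flat_iff` (`ε₀ = 0`: the envelope is the constant `A n` — the same zone lemmas
serve child 1A's (WG) proof, which is the flat tube).

ORDER OF RECORD (LADDER §52.3, TRAP-CANDIDATE #6). The tail shell from which the tube's `AheadClause` holds is
`ε₀`-DEPENDENT, `k₁ = k₁(ε₀) → ∞` (the format's `TailFat` ties the ahead tolerance to the kick radius `r = r(ε₀) → 0`),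
so the window gauge bound `G = g^{k₁(ε₀)⁺}` grows (polylogarithmically in `1/ε₀`). In the first form above the
scale-mismatch term `G·ξ·M_u ⊇ G·δ₁·M_u/(ω₀A_*)` then does NOT vanish as `ε₀ → 0` when `δ₁` is the `ε₀`-free (WG)
tolerance that fixes `N₀`. The forms of record are therefore `gauge_dev_le_of_window_and_tail₂` /
`core_landing_of_window_and_tail₂` (mismatch weighed by the gauge-profile constant `M_ω ≥ ω·|u⋆|`, tail bound on `y`
source-agnostic, two sources combined by `tail_of_two_sources`) and `entry_window_budget₂`, whose quantifier order
`∃ δ₁ > 0, ∀ G > 0, ∃ η₁ > 0, …` records that `δ₁` (hence `N₀`) is chosen before and independently of `G(ε₀)`, and only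
the capture radius `η₁` — which is `O(ε₀)` by finite-time continuity anyway — sees `G`.

HONEST FRAMING: MODEL lattice (graded mirror table on `S♭`); elementary real-number bookkeeping about the cell's typed
induction frame; nothing certified; no item moved; nothing about the Navier–Stokes equations.
-/

noncomputable section

set_option linter.dupNamespace false

namespace Summit.NavierStokesRegularity.NavierStokesRegularity.Theorems.HopTube

open Set Finset Literature.Analysis.FluidPDE Literature.Analysis.FluidPDE.TaoCascade

/-! ## Landing wrappers: the hypotheses of `coreClause_recentre` / `nearClause_recentre` / `behindClause_recentre` -/

section Landing

variable (P : TubeSchedule) {i₀ : Fin 2} {ustar : Fin 2 → ℤ → ℝ} {S : Fin 2 → ℤ → ℝ → ℝ} {τ₁ a : ℝ}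

/-- **ENTRY CORE, landing form.** With `y k := S (1+k) τ₁`, `x := |S i₀ 1 τ₁|/A_*`: the window data (W), the tail
data (T1) (from the landed ahead clause `8 w_k |S (1+k) τ₁| ≤ a r` and the domination `ω_k·(a r) ≤ 8 δ₂ w_k` beyond
`k₁`) and (T2), and the budget `max(G η₁ + δ₁ + G ξ M_u, δ₂ + δ₃) ≤ a·δ(n+1)` give `CoreClause` at `n+1` for the
re-centred state. [cite: Tao2016AveragedNS, §6.3–6.4 (checkpoint step, statement shape); cell LADDER §50.8, §52] -/
theorem core_landing_of_window_and_tail {n : ℕ} (ha : 0 < a) (hg : 1 ≤ P.g) (hb : 1 ≤ P.b)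
    {w : ℤ → ℝ} {r : ℝ} (hw : ∀ k, 0 < w k)
    {ref : Fin 2 → ℤ → ℝ} {xr η₁ δ₁ Mu ξ δ₂ δ₃ : ℝ} {k₁ : ℤ}
    (hwin : ∀ (i : Fin 2) (k : ℤ), -(P.K : ℤ) ≤ k → k < k₁ → |S i (1 + k) τ₁ - ref i k| ≤ η₁)
    (href : ∀ (i : Fin 2) (k : ℤ), -(P.K : ℤ) ≤ k → k < k₁ →
      MirrorPulse.geomGauge P.g P.b i k * |ref i k - xr * ustar i k| ≤ δ₁)
    (hMu : ∀ (i : Fin 2) (k : ℤ), -(P.K : ℤ) ≤ k → k < k₁ → |ustar i k| ≤ Mu)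
    (hx : abs (|S i₀ 1 τ₁| / P.Astar - xr) ≤ ξ)
    (hahead : ∀ (i : Fin 2) (k : ℤ), k₁ ≤ k → 8 * (w k * |S i (1 + k) τ₁|) ≤ a * r)
    (hdom : ∀ (i : Fin 2) (k : ℤ), k₁ ≤ k → MirrorPulse.geomGauge P.g P.b i k * (a * r) ≤ 8 * δ₂ * w k)
    (htu : ∀ (i : Fin 2) (k : ℤ), k₁ ≤ k →
      MirrorPulse.geomGauge P.g P.b i k * (abs (|S i₀ 1 τ₁| / P.Astar) * |ustar i k|) ≤ δ₃)
    (hbudget : max (P.g ^ k₁.toNat * η₁ + δ₁ + P.g ^ k₁.toNat * (ξ * Mu)) (δ₂ + δ₃) ≤ a * P.δ (n + 1)) :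
    CoreClause P i₀ ustar (n + 1) (recentre S τ₁ a) := by
  have hg0 : 0 < P.g := lt_of_lt_of_le zero_lt_one hg
  have hb0 : 0 < P.b := lt_of_lt_of_le zero_lt_one hb
  have hω : ∀ i k, 0 ≤ MirrorPulse.geomGauge P.g P.b i k :=
    fun i k => (MirrorPulse.geomGauge_pos hg0 hb0 i k).le
  have hty := gauge_tail_of_ahead (y := fun i k => S i (1 + k) τ₁) hω hw hahead hdom
  have hG : ∀ (i : Fin 2) (k : ℤ), -(P.K : ℤ) ≤ k → k < k₁ → MirrorPulse.geomGauge P.g P.b i k ≤ P.g ^ k₁.toNat :=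
    fun i k _ hk => geomGauge_le_pow_of_lt hg hb i hk
  have hmain := gauge_dev_le_of_window_and_tail (y := fun i k => S i (1 + k) τ₁) (u := ustar)
    (x := |S i₀ 1 τ₁| / P.Astar) hω hwin href hG hMu hx hty htu
  refine coreClause_recentre P ha (fun i k hk => ?_)
  exact (hmain i k hk).trans hbudget

/-- **ENTRY CORE, landing form with the SHARP mismatch term and a source-agnostic tail** (the form of record for the
`ε₀`-bookkeeping, LADDER §52.3): window data (W) with the gauge-profile constant `M_ω`, any gauge tail bound `δ₂` on
`y` from `k₁` on, the pulse gauge tail `δ₃`, and the budget `max(G η₁ + δ₁ + ξ M_ω, δ₂ + δ₃) ≤ a·δ(n+1)`, `G = g^{k₁⁺}`.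
[cite: Tao2016AveragedNS, §6.3–6.4 (checkpoint step, statement shape); cell LADDER §50.8, §52] -/
theorem core_landing_of_window_and_tail₂ {n : ℕ} (ha : 0 < a) (hg : 1 ≤ P.g) (hb : 1 ≤ P.b)
    {ref : Fin 2 → ℤ → ℝ} {xr η₁ δ₁ Mω ξ δ₂ δ₃ : ℝ} {k₁ : ℤ}
    (hwin : ∀ (i : Fin 2) (k : ℤ), -(P.K : ℤ) ≤ k → k < k₁ → |S i (1 + k) τ₁ - ref i k| ≤ η₁)
    (href : ∀ (i : Fin 2) (k : ℤ), -(P.K : ℤ) ≤ k → k < k₁ →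
      MirrorPulse.geomGauge P.g P.b i k * |ref i k - xr * ustar i k| ≤ δ₁)
    (hMω : ∀ (i : Fin 2) (k : ℤ), -(P.K : ℤ) ≤ k → k < k₁ →
      MirrorPulse.geomGauge P.g P.b i k * |ustar i k| ≤ Mω)
    (hx : abs (|S i₀ 1 τ₁| / P.Astar - xr) ≤ ξ)
    (hty : ∀ (i : Fin 2) (k : ℤ), k₁ ≤ k → MirrorPulse.geomGauge P.g P.b i k * |S i (1 + k) τ₁| ≤ δ₂)
    (htu : ∀ (i : Fin 2) (k : ℤ), k₁ ≤ k →
      MirrorPulse.geomGauge P.g P.b i k * (abs (|S i₀ 1 τ₁| / P.Astar) * |ustar i k|) ≤ δ₃)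
    (hbudget : max (P.g ^ k₁.toNat * η₁ + δ₁ + ξ * Mω) (δ₂ + δ₃) ≤ a * P.δ (n + 1)) :
    CoreClause P i₀ ustar (n + 1) (recentre S τ₁ a) := by
  have hg0 : 0 < P.g := lt_of_lt_of_le zero_lt_one hg
  have hb0 : 0 < P.b := lt_of_lt_of_le zero_lt_one hb
  have hω : ∀ i k, 0 ≤ MirrorPulse.geomGauge P.g P.b i k :=
    fun i k => (MirrorPulse.geomGauge_pos hg0 hb0 i k).le
  have hG : ∀ (i : Fin 2) (k : ℤ), -(P.K : ℤ) ≤ k → k < k₁ → MirrorPulse.geomGauge P.g P.b i k ≤ P.g ^ k₁.toNat :=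
    fun i k _ hk => geomGauge_le_pow_of_lt hg hb i hk
  have hmain := gauge_dev_le_of_window_and_tail₂ (y := fun i k => S i (1 + k) τ₁) (u := ustar)
    (x := |S i₀ 1 τ₁| / P.Astar) hω hwin href hG hMω hx hty htu
  refine coreClause_recentre P ha (fun i k hk => ?_)
  exact (hmain i k hk).trans hbudget

/-- **ENTRY CORE FROM GAUGE CAPTURE (R52-1, the recommended form).** With the capture clause in the head gauge
(converted by `gauge_capture_of_headGauge`), (WG) on `k ≥ -K`, the gauge-profile constant and the scale mismatch,
the budget `η₁ + δ₁ + ξ·M_ω ≤ a·δ(n+1)` gives `CoreClause` at `n+1` — all constants `ε₀`-free except `η₁ = O(ε₀)`.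
[cite: Tao2016AveragedNS, §6.3–6.4 (checkpoint step, statement shape); cell LADDER §50.8, §52.4] -/
theorem core_landing_of_gauge_capture {n : ℕ} (ha : 0 < a) (hg : 1 ≤ P.g) (hb : 1 ≤ P.b)
    {ref : Fin 2 → ℤ → ℝ} {xr η₁ δ₁ Mω ξ : ℝ}
    (hcap : ∀ (i : Fin 2) (k : ℤ), -(P.K : ℤ) ≤ k →
      MirrorPulse.geomGauge P.g P.b i k * |S i (1 + k) τ₁ - ref i k| ≤ η₁)
    (href : ∀ (i : Fin 2) (k : ℤ), -(P.K : ℤ) ≤ k →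
      MirrorPulse.geomGauge P.g P.b i k * |ref i k - xr * ustar i k| ≤ δ₁)
    (hMω : ∀ (i : Fin 2) (k : ℤ), -(P.K : ℤ) ≤ k → MirrorPulse.geomGauge P.g P.b i k * |ustar i k| ≤ Mω)
    (hx : abs (|S i₀ 1 τ₁| / P.Astar - xr) ≤ ξ)
    (hbudget : η₁ + δ₁ + ξ * Mω ≤ a * P.δ (n + 1)) :
    CoreClause P i₀ ustar (n + 1) (recentre S τ₁ a) := by
  have hg0 : 0 < P.g := lt_of_lt_of_le zero_lt_one hg
  have hb0 : 0 < P.b := lt_of_lt_of_le zero_lt_one hb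
  have hω : ∀ i k, 0 ≤ MirrorPulse.geomGauge P.g P.b i k :=
    fun i k => (MirrorPulse.geomGauge_pos hg0 hb0 i k).le
  have hmain := gauge_dev_le_of_gauge_capture (y := fun i k => S i (1 + k) τ₁) (u := ustar)
    (x := |S i₀ 1 τ₁| / P.Astar) hω hcap href hMω hx
  refine coreClause_recentre P ha (fun i k hk => ?_)
  exact (hmain i k hk).trans hbudget

/-- **ENTRY NEAR, landing form.** A sup deviation bound `e` on the block `[−D, −K−1]` gives the block energy bound
`card·e² ≤ a²·v(n+1)` ⇒ `NearClause` at `n+1` (weights `e^{θ_V (k+K)} ≤ 1` there, `θ_V ≥ 0`).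
[cite: Tao2016AveragedNS, §6.3–6.4 (statement shape); cell LADDER §49, §50.8, §52] -/
theorem near_landing_of_sup {n : ℕ} (ha : 0 < a) (hθ : 0 ≤ P.θV) {e : ℝ}
    (hdev : ∀ (i : Fin 2) (k : ℤ), -(P.D : ℤ) ≤ k → k ≤ -(P.K : ℤ) - 1 →
      |S i (1 + k) τ₁ - |S i₀ 1 τ₁| / P.Astar * ustar i k| ≤ e)
    (hbudget : ((Finset.Icc (-(P.D : ℤ)) (-(P.K : ℤ) - 1)).card : ℝ) * e ^ 2 ≤ a ^ 2 * P.v (n + 1)) :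
    NearClause P i₀ ustar (n + 1) (recentre S τ₁ a) := by
  refine nearClause_recentre P ha (le_trans ?_ hbudget)
  have hterm : ∀ k ∈ Finset.Icc (-(P.D : ℤ)) (-(P.K : ℤ) - 1),
      Real.exp (P.θV * ((k : ℝ) + P.K)) *
        ∑ i : Fin 2, (S i (1 + k) τ₁ - |S i₀ 1 τ₁| / P.Astar * ustar i k) ^ 2 / 2 ≤ e ^ 2 := by
    intro k hk
    rw [Finset.mem_Icc] at hk
    have hkR : (k : ℝ) ≤ -(P.K : ℝ) - 1 := by exact_mod_cast hk.2
    have hexp : Real.exp (P.θV * ((k : ℝ) + P.K)) ≤ 1 := by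
      rw [Real.exp_le_one_iff]
      exact mul_nonpos_iff.mpr (Or.inl ⟨hθ, by linarith⟩)
    have hsq : ∀ i : Fin 2, (S i (1 + k) τ₁ - |S i₀ 1 τ₁| / P.Astar * ustar i k) ^ 2 ≤ e ^ 2 := by
      intro i
      have h := hdev i k hk.1 hk.2
      have he0 : 0 ≤ e := (abs_nonneg _).trans h
      exact sq_le_sq' (by linarith [(abs_le.mp h).1]) (abs_le.mp h).2
    have hsum : ∑ i : Fin 2, (S i (1 + k) τ₁ - |S i₀ 1 τ₁| / P.Astar * ustar i k) ^ 2 / 2 ≤ e ^ 2 := by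
      rw [Fin.sum_univ_two]
      have h0 := hsq 0; have h1 := hsq 1
      nlinarith [sq_nonneg e]
    have hsum0 : 0 ≤ ∑ i : Fin 2, (S i (1 + k) τ₁ - |S i₀ 1 τ₁| / P.Astar * ustar i k) ^ 2 / 2 := by
      positivity
    calc Real.exp (P.θV * ((k : ℝ) + P.K)) *
          ∑ i : Fin 2, (S i (1 + k) τ₁ - |S i₀ 1 τ₁| / P.Astar * ustar i k) ^ 2 / 2
        ≤ 1 * ∑ i : Fin 2, (S i (1 + k) τ₁ - |S i₀ 1 τ₁| / P.Astar * ustar i k) ^ 2 / 2 :=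
          mul_le_mul_of_nonneg_right hexp hsum0
      _ ≤ e ^ 2 := by rw [one_mul]; exact hsum
  calc _ ≤ ∑ k ∈ Finset.Icc (-(P.D : ℤ)) (-(P.K : ℤ) - 1), e ^ 2 := Finset.sum_le_sum hterm
    _ = _ := by rw [Finset.sum_const, nsmul_eq_mul]

/-- **ENTRY BEHIND, landing form.** A sup bound `A₀` behind the window (junk amplitude + capture radius) with
`A₀ ≤ a·A(n+1)` gives `BehindClause` at `n+1` (the graded envelope factor is `≥ 1` for `ε₀, θ_b ≥ 0`).
[cite: Tao2016AveragedNS, §4 (4.5), §6.3–6.4 (statement shape); cell LADDER §47.5 L6, §50.8, §52] -/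
theorem behind_landing_of_sup {ε₀ : ℝ} {n : ℕ} (ha : 0 < a) (hε : 0 ≤ ε₀) (hθb : 0 ≤ P.θb) {A₀ : ℝ}
    (hsup : ∀ (i : Fin 2) (k : ℤ), k < -(P.K : ℤ) → |S i (1 + k) τ₁| ≤ A₀)
    (hbudget : A₀ ≤ a * P.A (n + 1)) :
    BehindClause P ε₀ (n + 1) (recentre S τ₁ a) := by
  refine behindClause_recentre P ha (fun i k hk => ?_)
  have hA0 : 0 ≤ a * P.A (n + 1) := le_trans ((abs_nonneg _).trans (hsup i k hk)) hbudget
  have hexp : 0 ≤ P.θb * min |(k : ℝ)| (((n + 1 : ℕ) : ℝ) + P.K₂) := by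
    apply mul_nonneg hθb
    exact le_min (abs_nonneg _) (by positivity)
  have hone : (1 : ℝ) ≤ (1 + ε₀) ^ (P.θb * min |(k : ℝ)| (((n + 1 : ℕ) : ℝ) + P.K₂)) :=
    Real.one_le_rpow (by linarith) hexp
  calc |S i (1 + k) τ₁| ≤ A₀ := hsup i k hk
    _ ≤ a * P.A (n + 1) := hbudget
    _ = a * P.A (n + 1) * 1 := (mul_one _).symm
    _ ≤ a * P.A (n + 1) * (1 + ε₀) ^ (P.θb * min |(k : ℝ)| (((n + 1 : ℕ) : ℝ) + P.K₂)) :=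
        mul_le_mul_of_nonneg_left hone hA0
    _ = a * (P.A (n + 1) * (1 + ε₀) ^ (P.θb * min |(k : ℝ)| (((n + 1 : ℕ) : ℝ) + P.K₂))) := mul_assoc _ _ _

end Landing

/-! ## The order of constants at entry, and the flat specialisation -/

/-- **ENTRY WINDOW BUDGET (order of constants).** Given the window gauge bound `G > 0`, the profile bound `M_u ≥ 0`,
the anchor `A_* > 0`, the anchor gauge `ω₀ > 0` and the entry core radius `δ̄ > 0`, ONE smallness `t` (:= `η₁ = δ₁`)
makes the window half of the core budget: `G t + t + G·((t + t/ω₀)/A_*)·M_u ≤ δ̄/2`. ORDER: `δ̄` is fixed by the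
tube (basin `δ̄ b^K ≲ 1 − ρ'`), then `t`; then `N₀` from child 1's (WG) at `(K + D, t)` and the capture radius
`η(N₀+1) ≤ t`; only then `ε₀ ≤ ε_cap(N₀, t) ∧ ε_entry(δ̄)` (tail half `δ₂ + δ₃ ≤ δ̄/2`: `δ₃` by `k₁ ≥ k⋆(δ̄)`, `δ₂ ∝ r₁ε₀`).
[cite: Tao2016AveragedNS, §6.4 (order of constants in the checkpoint argument, statement shape); cell LADDER §52] -/
theorem entry_window_budget {G Mu Astar ω₀ δbar : ℝ} (hG : 0 < G) (hMu : 0 ≤ Mu) (hA : 0 < Astar)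
    (hω₀ : 0 < ω₀) (hδ : 0 < δbar) :
    ∃ t : ℝ, 0 < t ∧ G * t + t + G * (((t + t / ω₀) / Astar) * Mu) ≤ δbar / 2 := by
  set L : ℝ := G + 1 + G * ((1 + 1 / ω₀) / Astar) * Mu with hL
  have hL0 : 0 < L := by rw [hL]; positivity
  have hLne : L ≠ 0 := hL0.ne'
  refine ⟨δbar / (2 * L), by positivity, ?_⟩
  have e : G * (δbar / (2 * L)) + δbar / (2 * L) + G * (((δbar / (2 * L) + δbar / (2 * L) / ω₀) / Astar) * Mu)
      = δbar / 2 * ((G + 1 + G * ((1 + 1 / ω₀) / Astar) * Mu) / L) := by ring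
  rw [e, ← hL, div_self hLne, mul_one]

/-- **ENTRY WINDOW BUDGET, ORDER OF RECORD** (LADDER §52.3): with the sharp mismatch term the (WG) tolerance `δ₁` is
chosen BEFORE and INDEPENDENTLY of the window gauge bound `G` — `δ₁ = δ̄ / (4(1 + M_ω/(ω₀A_*)))` depends on
`(δ̄, M_ω, ω₀, A_*)` only, hence so does `N₀ = N_WG(D, δ₁)` — and only the capture radius `η₁` (which is `O(ε₀)` anyway)
sees `G = g^{k₁(ε₀)⁺}`: `∃ δ₁ > 0, ∀ G > 0, ∃ η₁ > 0, G η₁ + δ₁ + ((η₁ + δ₁/ω₀)/A_*)·M_ω ≤ δ̄/2`.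
[cite: Tao2016AveragedNS, §6.4 (order of constants in the checkpoint argument, statement shape); cell LADDER §52] -/
theorem entry_window_budget₂ {Mω Astar ω₀ δbar : ℝ} (hMω : 0 ≤ Mω) (hA : 0 < Astar) (hω₀ : 0 < ω₀)
    (hδ : 0 < δbar) :
    ∃ δ₁ : ℝ, 0 < δ₁ ∧ ∀ G : ℝ, 0 < G →
      ∃ η₁ : ℝ, 0 < η₁ ∧ G * η₁ + δ₁ + ((η₁ + δ₁ / ω₀) / Astar) * Mω ≤ δbar / 2 := by
  set L₁ : ℝ := 1 + Mω / (ω₀ * Astar) with hL₁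
  have hL₁0 : 0 < L₁ := by rw [hL₁]; positivity
  have hL₁ne : L₁ ≠ 0 := hL₁0.ne'
  have hAne : Astar ≠ 0 := hA.ne'
  have hωne : ω₀ ≠ 0 := hω₀.ne'
  refine ⟨δbar / (4 * L₁), by positivity, fun G hG => ?_⟩
  set L₂ : ℝ := G + Mω / Astar + 1 with hL₂
  have hL₂0 : 0 < L₂ := by rw [hL₂]; positivity
  have hL₂ne : L₂ ≠ 0 := hL₂0.ne'
  refine ⟨δbar / (4 * L₂), by positivity, ?_⟩
  have hsplit : G * (δbar / (4 * L₂)) + δbar / (4 * L₁) + ((δbar / (4 * L₂) + δbar / (4 * L₁) / ω₀) / Astar) * Mω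
      = (δbar / (4 * L₂)) * (G + Mω / Astar) + (δbar / (4 * L₁)) * (1 + Mω / (ω₀ * Astar)) := by
    field_simp
    ring
  have hA' : (δbar / (4 * L₂)) * (G + Mω / Astar) ≤ δbar / 4 := by
    have hle : G + Mω / Astar ≤ L₂ := by rw [hL₂]; linarith
    have hnn : 0 ≤ δbar / (4 * L₂) := by positivity
    calc (δbar / (4 * L₂)) * (G + Mω / Astar) ≤ (δbar / (4 * L₂)) * L₂ := mul_le_mul_of_nonneg_left hle hnn
      _ = δbar / 4 := by field_simp
  have hB' : (δbar / (4 * L₁)) * (1 + Mω / (ω₀ * Astar)) = δbar / 4 := by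
    rw [← hL₁]; field_simp
  rw [hsplit]; linarith

/-- **FLAT SPECIALISATION (`ε₀ = 0`).** The behind envelope is the constant `A n`: the graded frame at `ε₀ = 0` is the
flat tube, whose per-hop zone lemmas are exactly what child 1A's clause (WG) («eventually in `N`») needs at `λ₀ = 1`.
[cite: Tao2016AveragedNS, §6.3–6.4 (statement shape); cell LADDER §49 (flat junk race), §52] -/
theorem behindClause_flat_iff (P : TubeSchedule) (n : ℕ) (z : Fin 2 → ℤ → ℝ) :
    BehindClause P 0 n z ↔ ∀ (i : Fin 2) (k : ℤ), k < -(P.K : ℤ) → |z i k| ≤ P.A n := by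
  unfold BehindClause
  simp only [add_zero, Real.one_rpow, mul_one]

/-- Flat ratio floor: at `ε₀ = 0` the clock obligation's floor `(1+ε₀)^{-θ₀} ≤ a` reads `1 ≤ a` (no rescaling slack —
the flat tube re-centres with `a ≥ 1` only; child 1A's convergence statement needs no format and no floor).
[cite: Tao2016AveragedNS, §6.4 (ratio floor, statement shape); cell LADDER §52] -/
theorem ratioFloor_flat (θ₀ : ℝ) : (1 + (0 : ℝ)) ^ (-θ₀) = 1 := by
  rw [add_zero, Real.one_rpow]

end Summit.NavierStokesRegularity.NavierStokesRegularity.Theorems.HopTube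

end
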